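import Literature.NumberTheory.EllipticCurves.IwasawaNakayamaProofs
import Literature.NumberTheory.EllipticCurves.IwasawaAlgebraCharIdealProofs
import Literature.NumberTheory.EllipticCurves.IwasawaAlgebraDivisibilityProofs
import Literature.NumberTheory.EllipticCurves.IwasawaAlgebraProofs
import Mathlib.RingTheory.Nakayama
import Mathlib.Topology.Instances.AddCircle.Defs
import HarnessLib

/-!
# Road (b″) of crux C2 `MainConjectureOfRankZeroBSDAtTwo` (stmt-BirchSwinnertonDyer-22298), line `birth`:
# CYCLIC `Λ`-MODULES KILLED BY `p` HAVE `(p)`-LENGTH `≤ 1` — Nakayama from a one-dimensional `X/𝔪X`, and the Pontryagin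
# form: a dual pair whose `S[𝔪]` has at most two elements (`p = 2`) has `ℓ₍₂₎(X) ≤ 1`

HONEST FRAMING (cell `bsd-f1-sign2`, attach seat `bsd-line-att-p4` g5, route `AlignedTransportAtTwo`; BSD is NOT proved by any of
this; the crux C2 stays OPEN). THEOREMS ONLY (pure commutative algebra on `Λ = ℤ_p⟦T⟧`); `--supports stmt-BirchSwinnertonDyer-22298`,
C2-NEUTRAL. Purpose: the algebra half of the UPPER bound `ℓ₍₂₎(ker q) ≤ 1` for the archimedean kernel of road (b″)
(`…FineRoadArchReceptacle`/`ArchRigidity`: `q : X^{rel ∞} ↠ X`, `2·ker q = 0`) — «Greenberg's `(Λ/2Λ)^{[Δ_E>0]}` is the most the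
archimedean factor can be» (LNM 1716 §4 Remark after Lemma 4.6) in `μ`-form.

* §1 Nakayama on the local ring `Λ`: `⊤ ≤ Λx₀ + 𝔪X ⟹ X = Λx₀` (`span_singleton_eq_top_of_le_sup_maximalIdeal_smul`); the
  «at most two classes mod `𝔪X`» dichotomy ⟹ `X` cyclic (`exists_span_singleton_eq_top_of_dichotomy`); a cyclic `X` killed by `C p`
  is a quotient of `Λ/(p)` and so has `ℓ_{(p)}(X) ≤ 1` (`lengthAt_le_one_of_cyclic_of_C_smul_eq_zero`, with `ℓ_{(p)}(Λ/(p)) = 1`).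
* §2 Pontryagin form at `p = 2` (`lengthAt_le_one_of_isDualPair_two`): for an axiomatic dual pair `(X, S, ψ)` (`IwasawaDual.IsDualPair 2`)
  with `X` finitely generated, `2X = 0` and `S[𝔪] = {s | 2s = 0, ψ s = 0} ⊆ {0, s₀}`: `ℓ₍₂₎(X) ≤ 1` — characters are compared on `s₀`
  (the only element of order `2` in `ℚ/ℤ` is `½`, Mathlib `AddCircle.card_addOrderOf_eq_totient`), a character killing `S[𝔪]` lies in
  `2X + TX ⊆ 𝔪X` (the tree's `IsDualPair.mem_mPow_one_of_mem_annPiece`, Lang Ch. 5 §1), and §1 applies.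

References: S. Lang, *Cyclotomic Fields I–II*, Ch. 5 §1 (Nakayama); L. Washington, GTM 83, §13.2; R. Greenberg, LNM 1716 (1999),
§4 p. 106.
-/

set_option autoImplicit false
-- the Theorems namespace of this sub repeats the summit name by design (D-0017 nested layout)
set_option linter.dupNamespace false

noncomputable section

open scoped Classical

namespace Summit.BirchSwinnertonDyer.BirchSwinnertonDyer.Theorems.AlignedTransportAtTwoFineRoad.CyclicLength

open Literature.NumberTheory.EllipticCurves Literature.NumberTheory.EllipticCurves.IwasawaAlgebra
  Literature.NumberTheory.EllipticCurves.Module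

/-! ## §1 Nakayama on `Λ`: one generator mod `𝔪` ⟹ cyclic ⟹ `ℓ_{(p)} ≤ 1` when killed by `p` -/

section Nakayama

variable {p : ℕ} [Fact p.Prime] {X : Type*} [AddCommGroup X] [_root_.Module (IwasawaAlgebra p) X]

/-- **Nakayama on the local ring `Λ = ℤ_p⟦T⟧`**: if `X` is finitely generated and `X ≤ Λ·x₀ + 𝔪·X` then `X = Λ·x₀`
(Mathlib `Submodule.le_of_le_smul_of_le_jacobson_bot`, `𝔪 = jacobson ⊥`). [cite: Lang1990, Ch. 5 §1 (Nakayama's lemma)] -/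
theorem span_singleton_eq_top_of_le_sup_maximalIdeal_smul [Module.Finite (IwasawaAlgebra p) X] (x₀ : X)
    (h : (⊤ : Submodule (IwasawaAlgebra p) X) ≤
      (IwasawaAlgebra p ∙ x₀) ⊔ IsLocalRing.maximalIdeal (IwasawaAlgebra p) • (⊤ : Submodule (IwasawaAlgebra p) X)) :
    (IwasawaAlgebra p ∙ x₀) = ⊤ :=
  le_antisymm le_top (Submodule.le_of_le_smul_of_le_jacobson_bot Module.Finite.fg_top
    (by rw [IsLocalRing.jacobson_eq_maximalIdeal]; exact bot_ne_top) h)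

/-- **Two classes mod `𝔪X` ⟹ cyclic**: if for all `x, y ∈ X` one of `x`, `y`, `x − y` lies in `𝔪X` (i.e. `X/𝔪X` has at most two
elements), then `X = Λ·x₀` for some `x₀` (Nakayama; `x₀ = 0` if `X = 𝔪X`). [cite: Lang1990, Ch. 5 §1 (Nakayama's lemma)] -/
theorem exists_span_singleton_eq_top_of_dichotomy [Module.Finite (IwasawaAlgebra p) X]
    (h : ∀ x y : X, x ∈ IsLocalRing.maximalIdeal (IwasawaAlgebra p) • (⊤ : Submodule (IwasawaAlgebra p) X) ∨
      y ∈ IsLocalRing.maximalIdeal (IwasawaAlgebra p) • (⊤ : Submodule (IwasawaAlgebra p) X) ∨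
      x - y ∈ IsLocalRing.maximalIdeal (IwasawaAlgebra p) • (⊤ : Submodule (IwasawaAlgebra p) X)) :
    ∃ x₀ : X, (IwasawaAlgebra p ∙ x₀) = ⊤ := by
  by_cases hall : ∀ x : X, x ∈ IsLocalRing.maximalIdeal (IwasawaAlgebra p) • (⊤ : Submodule (IwasawaAlgebra p) X)
  · exact ⟨0, span_singleton_eq_top_of_le_sup_maximalIdeal_smul 0 fun x _ ↦ Submodule.mem_sup_right (hall x)⟩
  · obtain ⟨x₀, hx₀⟩ := not_forall.mp hall
    refine ⟨x₀, span_singleton_eq_top_of_le_sup_maximalIdeal_smul x₀ fun y _ ↦ ?_⟩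
    rcases h x₀ y with h0 | hy | hxy
    · exact absurd h0 hx₀
    · exact Submodule.mem_sup_right hy
    · have e : y = x₀ - (x₀ - y) := by abel
      rw [e]
      exact Submodule.sub_mem _ (Submodule.mem_sup_left (Submodule.mem_span_singleton_self x₀))
        (Submodule.mem_sup_right hxy)

/-- **A cyclic `Λ`-module killed by `p` has `ℓ_{(p)} ≤ 1`**: `X = Λ·x₀` with `C(p)·X = 0` is a quotient of `Λ/(p)`, whose `(p)`-length
is `1` (`(p)` has height one; tree `lengthAt_quotient_span_singleton`). [cite: Washington1997, §13.2] -/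
theorem lengthAt_le_one_of_cyclic_of_C_smul_eq_zero (x₀ : X) (hx₀ : (IwasawaAlgebra p ∙ x₀) = ⊤)
    (hp : ∀ x : X, (PowerSeries.C (p : ℤ_[p]) : IwasawaAlgebra p) • x = 0) :
    lengthAt (IwasawaAlgebra p) X ⟨augIdealP p, isPrime_augIdealP_holds p⟩ ≤ 1 := by
  -- the surjection `Λ/(p) ↠ X`, `f ↦ f • x₀`
  have hg : Ideal.span {(PowerSeries.C (p : ℤ_[p]) : IwasawaAlgebra p)} ≤
      LinearMap.ker (LinearMap.toSpanSingleton (IwasawaAlgebra p) X x₀) := by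
    intro a ha
    obtain ⟨b, rfl⟩ := Ideal.mem_span_singleton'.mp ha
    rw [LinearMap.mem_ker, LinearMap.toSpanSingleton_apply, mul_smul, hp, smul_zero]
  have hsurj : Function.Surjective
      ((Ideal.span {(PowerSeries.C (p : ℤ_[p]) : IwasawaAlgebra p)}).liftQ
        (LinearMap.toSpanSingleton (IwasawaAlgebra p) X x₀) hg) := by
    intro x
    have hx : x ∈ (IwasawaAlgebra p ∙ x₀) := by rw [hx₀]; exact Submodule.mem_top
    obtain ⟨a, ha⟩ := Submodule.mem_span_singleton.mp hx
    exact ⟨Submodule.Quotient.mk a, by rw [Submodule.liftQ_apply, LinearMap.toSpanSingleton_apply, ha]⟩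
  have h1 : lengthAt (IwasawaAlgebra p)
      (IwasawaAlgebra p ⧸ Ideal.span {(PowerSeries.C (p : ℤ_[p]) : IwasawaAlgebra p)})
      ⟨augIdealP p, isPrime_augIdealP_holds p⟩ = 1 := by
    have h := lengthAt_quotient_span_singleton (R := IwasawaAlgebra p) (prime_C p)
      ⟨augIdealP p, isPrime_augIdealP_holds p⟩ (height_augIdealP_holds p)
    rw [h, if_pos (show (PowerSeries.C (p : ℤ_[p]) : IwasawaAlgebra p) ∈
      (⟨augIdealP p, isPrime_augIdealP_holds p⟩ : PrimeSpectrum (IwasawaAlgebra p)).asIdeal from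
        Ideal.mem_span_singleton_self _)]
  exact (lengthAt_le_of_surjective _ hsurj ⟨augIdealP p, isPrime_augIdealP_holds p⟩).trans h1.le

/-- `p·x ∈ 𝔪X` and `T·x ∈ 𝔪X` (`p, T ∈ 𝔪 = (p, T)`); hence the tree's filtration step `mPow p 1 = pX + TX ≤ 𝔪X`.
[cite: Lang1990, Ch. 5 §1] -/
theorem mPow_one_le_maximalIdeal_smul :
    IwasawaDual.mPow p (X := X) 1 ≤
      (IsLocalRing.maximalIdeal (IwasawaAlgebra p) • (⊤ : Submodule (IwasawaAlgebra p) X)).toAddSubgroup := by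
  intro x hx
  change x ∈ (IwasawaDual.mPow p 0).map _ ⊔ (IwasawaDual.mPow p 0).map _ at hx
  obtain ⟨y, hy, z, hz, rfl⟩ := AddSubgroup.mem_sup.mp hx
  obtain ⟨y', -, rfl⟩ := AddSubgroup.mem_map.mp hy
  obtain ⟨z', -, rfl⟩ := AddSubgroup.mem_map.mp hz
  simp only [DistribSMul.toAddMonoidHom_apply]
  have hX : (PowerSeries.X : IwasawaAlgebra p) ∈ IsLocalRing.maximalIdeal (IwasawaAlgebra p) := by
    rw [IsLocalRing.mem_maximalIdeal, mem_nonunits_iff, PowerSeries.isUnit_iff_constantCoeff]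
    simp
  refine AddSubgroup.add_mem _ ?_ (Submodule.smul_mem_smul hX Submodule.mem_top)
  have e : p • y' = (PowerSeries.C (p : ℤ_[p]) : IwasawaAlgebra p) • y' := by
    rw [map_natCast, Nat.cast_smul_eq_nsmul]
  rw [e]
  exact Submodule.smul_mem_smul (C_p_mem_maximalIdeal p) Submodule.mem_top

end Nakayama

/-! ## §2 Pontryagin form at `p = 2`: `S[𝔪] ⊆ {0, s₀}` ⟹ `ℓ₍₂₎(X) ≤ 1` -/

section DualPair

variable {S : Type*} [AddCommGroup S] {ψ : AddMonoid.End S}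
  {X : Type*} [AddCommGroup X] [_root_.Module (IwasawaAlgebra 2) X] {toDual : X →+ (S →+ AddCircle (1 : ℚ))}

/-- The only element of order `2` in `ℚ/ℤ` is `½`: two non-zero `2`-torsion elements of `AddCircle (1 : ℚ)` are equal
(Mathlib `AddCircle.card_addOrderOf_eq_totient`, `φ(2) = 1`). [folklore] -/
theorem eq_of_two_nsmul_eq_zero {u v : AddCircle (1 : ℚ)} (hu : (2 : ℕ) • u = 0) (hu0 : u ≠ 0) (hv : (2 : ℕ) • v = 0)
    (hv0 : v ≠ 0) : u = v := by
  have hou : addOrderOf u = 2 := addOrderOf_eq_prime hu hu0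
  have hov : addOrderOf v = 2 := addOrderOf_eq_prime hv hv0
  have h1 : Nat.card {w : AddCircle (1 : ℚ) // addOrderOf w = 2} = 1 := by
    rw [AddCircle.card_addOrderOf_eq_totient, Nat.totient_prime Nat.prime_two]
  haveI : Subsingleton {w : AddCircle (1 : ℚ) // addOrderOf w = 2} := (Nat.card_eq_one_iff_unique.mp h1).1
  exact congrArg Subtype.val (Subsingleton.elim (⟨u, hou⟩ : {w : AddCircle (1 : ℚ) // addOrderOf w = 2}) ⟨v, hov⟩)

/-- **`S[𝔪] ⊆ {0, s₀}` ⟹ two classes mod `𝔪X`**: for a dual pair `(X, S, ψ)` at `p = 2` (`IwasawaDual.IsDualPair`) whose first piece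
`S[𝔪] = {s | 2s = 0, ψ s = 0}` is contained in `{0, s₀}`, any two `x, y ∈ X` have `x`, `y` or `x − y` in `𝔪X`: compare the values
`toDual x s₀, toDual y s₀ ∈ (ℚ/ℤ)[2] = {0, ½}`; a character killing `S[𝔪]` lies in `2X + TX` (tree `IsDualPair.mem_mPow_one_of_mem_annPiece`,
the Pontryagin exactness `(X/𝔪X)^∨ = S[𝔪]`). [cite: Lang1990, Ch. 5 §1] [cite: GreenbergLNM1716, §1 p. 60] -/
theorem dichotomy_of_piece_one_pair (h : IwasawaDual.IsDualPair 2 ψ toDual) {s₀ : S}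
    (hpiece : ∀ s ∈ IwasawaDual.piece 2 ψ 1, s = 0 ∨ s = s₀) (x y : X) :
    x ∈ IsLocalRing.maximalIdeal (IwasawaAlgebra 2) • (⊤ : Submodule (IwasawaAlgebra 2) X) ∨
      y ∈ IsLocalRing.maximalIdeal (IwasawaAlgebra 2) • (⊤ : Submodule (IwasawaAlgebra 2) X) ∨
      x - y ∈ IsLocalRing.maximalIdeal (IwasawaAlgebra 2) • (⊤ : Submodule (IwasawaAlgebra 2) X) := by
  -- a character vanishing at `s₀` kills `S[𝔪]`, hence lies in `𝔪X`
  have key : ∀ z : X, toDual z s₀ = 0 →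
      z ∈ IsLocalRing.maximalIdeal (IwasawaAlgebra 2) • (⊤ : Submodule (IwasawaAlgebra 2) X) := by
    intro z hz
    have hann : z ∈ IwasawaDual.annPiece 2 ψ toDual 1 := by
      rw [IwasawaDual.mem_annPiece]
      intro s hs
      rcases hpiece s hs with rfl | rfl
      · rw [map_zero]
      · exact hz
    exact mPow_one_le_maximalIdeal_smul (h.mem_mPow_one_of_mem_annPiece hann)
  by_cases hs₀ : s₀ ∈ IwasawaDual.piece 2 ψ 1
  · -- `2 s₀ = 0`, so the values at `s₀` are `2`-torsion
    have h2 : ∀ z : X, (2 : ℕ) • toDual z s₀ = 0 := fun z ↦ by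
      rw [← map_nsmul, ← pow_one 2, (IwasawaDual.mem_piece.mp hs₀).1, map_zero]
    by_cases hx : toDual x s₀ = 0
    · exact Or.inl (key x hx)
    by_cases hy : toDual y s₀ = 0
    · exact Or.inr (Or.inl (key y hy))
    refine Or.inr (Or.inr (key (x - y) ?_))
    rw [map_sub, AddMonoidHom.sub_apply, eq_of_two_nsmul_eq_zero (h2 x) hx (h2 y) hy, sub_self]
  · -- `S[𝔪] = 0`: every character kills it
    refine Or.inl (mPow_one_le_maximalIdeal_smul (h.mem_mPow_one_of_mem_annPiece ?_))
    rw [IwasawaDual.mem_annPiece]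
    intro s hs
    rcases hpiece s hs with rfl | rfl
    · rw [map_zero]
    · exact absurd hs hs₀

/-- **`S[𝔪] ⊆ {0, s₀}` and `2X = 0` ⟹ `ℓ₍₂₎(X) ≤ 1`** for a finitely generated dual pair `(X, S, ψ)` at `p = 2`: `X` is cyclic
(`dichotomy_of_piece_one_pair` + Nakayama) and killed by `2`, hence a quotient of `Λ/2Λ`. This is the algebra of the UPPER bound on
the archimedean `μ`-defect of road (b″): `ker q = (Sel^{rel ∞}/Sel)^∨` is killed by `2` and its `S[𝔪]` is `(Sel^{rel ∞}/Sel)^Γ`.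
[cite: Lang1990, Ch. 5 §1] [cite: GreenbergLNM1716, §4 Remark after Lemma 4.6 (PDF p. 106)] -/
theorem lengthAt_le_one_of_isDualPair_two [Module.Finite (IwasawaAlgebra 2) X] (h : IwasawaDual.IsDualPair 2 ψ toDual)
    (h2 : ∀ x : X, (2 : ℕ) • x = 0) {s₀ : S} (hpiece : ∀ s ∈ IwasawaDual.piece 2 ψ 1, s = 0 ∨ s = s₀) :
    lengthAt (IwasawaAlgebra 2) X ⟨augIdealP 2, isPrime_augIdealP_holds 2⟩ ≤ 1 := by
  obtain ⟨x₀, hx₀⟩ := exists_span_singleton_eq_top_of_dichotomy (dichotomy_of_piece_one_pair h hpiece)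
  refine lengthAt_le_one_of_cyclic_of_C_smul_eq_zero x₀ hx₀ fun x ↦ ?_
  rw [show ((2 : ℕ) : ℤ_[2]) = 2 from rfl, map_ofNat, ofNat_smul_eq_nsmul]
  exact h2 x

end DualPair

end Summit.BirchSwinnertonDyer.BirchSwinnertonDyer.Theorems.AlignedTransportAtTwoFineRoad.CyclicLength

end
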